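import Literature.Computability.Complexity.CNF
import Literature.Computability.Complexity.CodeFPStrings
import Literature.Computability.Complexity.LengthCompare
import HarnessLib

/-!
# PneNP / OverlapGapAlgebra — support item `EvalRelationInP` (stmt-PneNP-2465)

Route `PneNP/OverlapGapAlgebra`, support item stmt-PneNP-2465 (`EvalRelationInP`, assembly
plumbing): CNF evaluation is polynomial time **as a relation** in the tree's model — there is a
language `R ∈ Classes.P` with

  `⟨⌜φ⌝, y⟩ ∈ R ↔ φ.eval (i ↦ y.getD i false) = true`

for every CNF `φ` over `ℕ` (code `⌜φ⌝ = encodingCNF.encode φ`, pairing `boolPair`) and every table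
`y : List Bool`.

The machine content is assembled in the typed `CodeFP` algebra (`CodeFP.lean`, `CodeFPStrings.lean`):
the evaluation map `(φ, y) ↦ φ.eval (i ↦ y.getD i false)` is computed on codes by a string function
`f ∈ FP` (`overlapGap_codeFP_cnfEval`: a literal by `strGetDNat` and `beq`, a clause by `any`, the CNF
by `all`, length headers dropped by `rawOfList`; `encodingCNF.encode = listE (listE (pairE natE bitE))`
by unfolding), and the language is cut out by the one-bit test `headBitFn ∘ f` (`mem_P_of_mem_FP`,
`LengthCompare.lean`).  Off codewords `R` is whatever `f` does
there (the item leaves it free).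

The theorem is stated STRUCTURALLY (the body of the route decl
`Summit.PneNP.PneNP.Theses.OverlapGapAlgebra.EvalRelationInP`, verbatim) and this file deliberately
does NOT import the route file `Summits.PneNP.PneNP.Theses.OverlapGapAlgebra`, so that the gate can
link `EvalRelationInP_holds` by importing this module into the route file without an import cycle
(same convention as `SzkEntropyPeaMemPH.lean`, `SzkEntropyCookModelBridgeStandalone.lean`).

References: S. Arora, B. Barak, *Computational Complexity: A Modern Approach*, CUP 2009, §1.3
(closure of polynomial time under composition and bounded loops), Def. 1.13 (`P`), §2.1, §2.3
(codes of CNF formulas).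
-/

namespace Summit.PneNP.PneNP.Theorems

set_option linter.dupNamespace false -- `Summit.PneNP.PneNP.…`: summit = sub-problem (D-0017)

open Literature.Computability.Complexity Literature.Computability.Complexity.CodeFP
open Literature.Computability.Complexity.Brick Computability

/-- **CNF evaluation is computed on codes by a polynomial-time string function**: the map
`(φ, y) ↦ φ.eval (i ↦ y.getD i false)` from `⟨⌜φ⌝, y⟩` to one bit is `CodeFP`
(literal: `y[v] == b` by `strGetDNat`/`beq`; clause: `any`; CNF: `all`). [AroraBarakCC2009, §1.3] -/
theorem overlapGap_codeFP_cnfEval :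
    CodeFP (pairE (listE (listE (pairE natE bitE))) strE) bitE
      (fun p : CNF ℕ × List Bool => p.1.eval (fun i => p.2.getD i false)) := by
  -- a literal `(v, b)` under the table `y`: `y[v] == b`
  have hlit : CodeFP (pairE strE (pairE natE bitE)) bitE
      (fun t : List Bool × (ℕ × Bool) => (t.1.getD t.2.1 false == t.2.2)) :=
    (beq bitE_injective).comp₂ (strGetDNat.comp₂ (fst _ _) (snd _ _).fst') (snd _ _).snd'
  -- a clause (raw list of literals): some literal is true
  have hcl : CodeFP (pairE strE (rawE (pairE natE bitE))) bitE
      (fun q : List Bool × Clause ℕ => q.2.any (fun l => (q.1.getD l.1 false == l.2))) := any hlit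
  -- a clause given with its length header
  have hcl' : CodeFP (pairE strE (listE (pairE natE bitE))) bitE
      (fun q : List Bool × Clause ℕ => q.2.any (fun l => (q.1.getD l.1 false == l.2))) :=
    (hcl.comp ((fst _ _).pair ((rawOfList _).comp (snd _ _)))).congr fun _ => rfl
  -- the CNF (raw list of headed clauses): every clause has a true literal
  have hcnf : CodeFP (pairE strE (rawE (listE (pairE natE bitE)))) bitE
      (fun q : List Bool × CNF ℕ => q.2.all (fun c => c.any (fun l => (q.1.getD l.1 false == l.2)))) :=
    all hcl'
  -- swap the components and drop the outer length header
  refine ((hcnf.comp ((snd _ _).pair ((rawOfList _).comp (fst _ _)))).congr fun p => ?_)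
  rfl

/-- **Item `EvalRelationInP` (route `OverlapGapAlgebra`, stmt-PneNP-2465), spelled verbatim as the
body of the route decl**: CNF evaluation is polynomial time as a relation — some `R ∈ Classes.P`
satisfies `⟨⌜φ⌝, y⟩ ∈ R ↔ φ.eval (i ↦ y.getD i false) = true` for all CNFs `φ` over `ℕ` and all
tables `y : List Bool`.  `R` is the one-bit test `headBitFn ∘ f = [1]` of the `FP` function `f` of
`overlapGap_codeFP_cnfEval`. [AroraBarakCC2009, §1.3, Def. 1.13] -/
theorem overlapGap_evalRelationInP :
    ∃ R ∈ Literature.Computability.Complexity.Classes.P, ∀ (φ : Literature.Computability.Complexity.CNF ℕ) (y : List Bool), Literature.Computability.Complexity.boolPair (Literature.Computability.Complexity.encodingCNF.encode φ) y ∈ R ↔ φ.eval (fun i => y.getD i false) = true := by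
  obtain ⟨f, hf, hfg⟩ := overlapGap_codeFP_cnfEval
  refine ⟨{w | HashBricks.headBitFn (f w) = [true]}, ?_, ?_⟩
  · refine mem_P_of_mem_FP (PolyTimeComputable.comp_holds HashBricks.headBitFn_mem_FP hf) _
      fun w => ⟨fun h => h, fun h => ?_⟩
    have h' : HashBricks.headBitFn (f w) ≠ [true] := h
    show HashBricks.headBitFn (f w) = [false]
    rw [HashBricks.headBitFn_apply] at h' ⊢
    revert h'
    cases (f w).headD false <;> simp
  · intro φ y
    -- the code of a CNF is the headed list of headed lists of `⟨binary variable, [polarity]⟩`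
    have hcnfE : (encodingCNF.encode : CNF ℕ → List Bool) = listE (listE (pairE natE bitE)) := by
      rw [encodingCNF, listE_eq, encodingClause, listE_eq, encodingLiteral, pairE_eq, natE_eq, bitE_eq]
    have hcode : boolPair (encodingCNF.encode φ) y =
        pairE (listE (listE (pairE natE bitE))) strE (φ, y) := by
      rw [hcnfE]; rfl
    change HashBricks.headBitFn (f (boolPair (encodingCNF.encode φ) y)) = [true] ↔ _
    rw [hcode, hfg, HashBricks.headBitFn_apply]
    simp [bitE]

end Summit.PneNP.PneNP.Theorems
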